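import Mathlib.GroupTheory.Finiteness
import Literature.AnabelianGeometry.SemiGraphs.TemperedAnabelianLem63iiiProofs
import Literature.AnabelianGeometry.SemiGraphs.TemperedAnabelianThm66SubProofs
import HarnessLib

/-!
# [SemiAnbd] §6 from the virtually free tower: Lemma 6.3 (ii)/(iii) at coverings, Theorems 6.4 and 6.6

Mochizuki, *Semi-graphs of anabelioids*, Publ. RIMS **42** (2006) [SemiAnbd], §6, author's
manuscript pp. 69–73. [cite: MochizukiSemiAnbd2006, §6 pp.69-73]

PROOF-ONLY companion (abc-iut cell, sub-DAGs `SemiAnbd:Lem6.3(ii)`, `SemiAnbd:Lem6.1(iii)+Lem6.3(iii)`,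
prover abc-iut-w5-d240; no definitions, no named facts introduced).  It assembles the tree's sub-DAG
reduction of [SemiAnbd] Theorem 6.6 (`TemperedCurve.profiniteOuterIsoLifts_of_system`) and the sub-node
T64-L06′ of Theorem 6.4 (`TemperedCurve.OpenDenseDOFConjugator`, abc-iut-w5-d139) with the proofs of
Lemma 6.1 (iii), 6.3 (iii) over the tower (`TemperedAnabelianLem63iiiProofs`), so that the ONLY inputs
about `Π^temp_{Y_L}` left in Theorem 6.6 (and, with `TemperedAnabelianThm64OfTowerProofs`, in
Theorem 6.4) are

* `IsTempered Y.PiTemp` ([SemiAnbd] Def. 3.1 (i); p. 69 "a tempered topological group"), and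
* the tower input `htower₀`: cofinally many open normal `N ⊴ Π^temp_{Y_L}` with `Π^temp_{Y_L}/N`
  containing a NON-ABELIAN free normal subgroup of finite index and finite rank ([André] §4.5; the
  very input of the tree's discharge of [EtTh] Lem. 2.17 (ii)),

besides the inputs that are not about `Π^temp` as a topological group (the `π₁^temp`-functor clauses,
[Mzk8] Thm. 1.2, the specialisation isomorphism systems).  Contents:

* `virtuallyFreeQuotients_of_tower` — the tower input implies the
  hypothesis (VF) of `TemperedAnabelianLem63iiProofs` (Lemma 6.3 (ii); the corollary
  `piTempDFGIffDOF_of_tower` and Theorem 6.4 over the tower are in `TemperedAnabelianThm64OfTowerProofs`);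
* `IsTempered.mem_range_of_conj_eq_of_closure_eq` — Lemma 6.3 (iii) for subgroups dense in an OPEN
  SUBGROUP OF FINITE INDEX `U` (the generality "by replacing `F` by an open subgroup of `F` of finite
  index", p. 70, that the proof of Thm. 6.4 uses): level-wise [EtTh] Lem. 2.17 (i) (`lem217_i`) at
  `H = U/N`, glued by `IsTempered.exists_apply_eq_of_levelwise`;
  `TemperedCurve.openDenseDOFConjugator_of_tower` = sub-node T64-L06′ (`OpenDenseDOFConjugator`);
* `TemperedOrigin.profiniteOuterIsoLiftsHolds_of_tower` — [SemiAnbd] Thm. 6.6 modulo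
  {`SpecializationIsoSystemHolds`, `IsTempered`, `htower₀`} (the Lemma 6.1 (ii)(iii) input
  `ProfiniteNormalizersHolds` of `profiniteOuterIsoLiftsHolds_of` replaced by the tower input).

Classical topological group theory + bookkeeping; nothing here concerns the disputed parts of
inter-universal Teichmüller theory or takes a side on [IUTchIII] Cor. 3.12; typed ≠ discharged.
-/

noncomputable section

namespace Literature.AnabelianGeometry.SemiGraphs

open CategoryTheory ProfiniteGrp ProfiniteGrp.ProfiniteCompletion
open _root_.Topology
open scoped Pointwise
open Literature.AnabelianGeometry.EtaleTheta.DiscreteNormalizers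

universe u v

section Generic

variable {P : Type u} [Group P] [TopologicalSpace P] [IsTopologicalGroup P]
variable {Ph : Type v} [Group Ph] [TopologicalSpace Ph] [IsTopologicalGroup Ph]

/-! ### The tower input implies the virtually-free-quotients input (VF) of Lemma 6.3 (ii) -/

/-- A group with a finitely generated subgroup of finite index is finitely generated (generators of
the subgroup together with coset representatives). [folklore] -/
private theorem fg_of_fg_subgroup_of_finiteIndex {Q : Type u} [Group Q] (G : Subgroup Q) [G.FiniteIndex]
    [Group.FG G] : Group.FG Q := by
  classical
  obtain ⟨S, hS⟩ := (Group.fg_iff_subgroup_fg G).mp ‹_›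
  haveI : Finite (Q ⧸ G) := Subgroup.finite_quotient_of_finiteIndex
  refine Group.fg_iff.mpr ⟨(S : Set Q) ∪ Set.range (fun c : Q ⧸ G => c.out), ?_,
    (S.finite_toSet).union (Set.finite_range _)⟩
  rw [eq_top_iff]
  intro q _
  have hG : G ≤ Subgroup.closure ((S : Set Q) ∪ Set.range (fun c : Q ⧸ G => c.out)) := by
    rw [← hS]
    exact Subgroup.closure_mono Set.subset_union_left
  have hout : ((q : Q ⧸ G).out)⁻¹ * q ∈ G := by
    rw [← QuotientGroup.eq, QuotientGroup.out_eq']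
  have h1 : (q : Q ⧸ G).out ∈ Subgroup.closure ((S : Set Q) ∪ Set.range (fun c : Q ⧸ G => c.out)) :=
    Subgroup.subset_closure (Set.mem_union_right _ ⟨q, rfl⟩)
  have h2 := Subgroup.mul_mem _ h1 (hG hout)
  simpa using h2

omit [TopologicalSpace P] [IsTopologicalGroup P] in
/-- A group with a normal free subgroup of finite index and finite rank is finitely generated and
virtually free. [folklore] -/
private theorem fg_and_virtuallyFree_of_freeNormal {Q : Type u} [Group Q] (G : Subgroup Q) [IsFreeGroup G]
    (hGn : G.Normal) (hGfi : G.FiniteIndex) (hGfin : Finite (IsFreeGroup.Generators G)) :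
    Group.FG Q ∧ ∃ N : Subgroup Q, N.Normal ∧ N.FiniteIndex ∧ IsFreeGroup N := by
  haveI := hGfi
  haveI : Group.FG G :=
    Group.fg_of_surjective (f := (IsFreeGroup.toFreeGroup G).symm.toMonoidHom)
      (IsFreeGroup.toFreeGroup G).symm.surjective
  exact ⟨fg_of_fg_subgroup_of_finiteIndex G, G, hGn, hGfi, inferInstance⟩

omit [IsTopologicalGroup P] in
/-- The tower input `htower₀` (cofinal open normal `N` with `Π/N ⊇` a non-abelian free normal subgroup
of finite index and finite rank) implies the input (VF) of `TemperedAnabelianLem63iiProofs` (cofinal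
open normal `J` with `Π/J` finitely generated and virtually free).
[cite: MochizukiSemiAnbd2006, Lem 6.3(ii) p.70] -/
theorem virtuallyFreeQuotients_of_tower
    (htower₀ : ∀ U ∈ 𝓝 (1 : P), ∃ N : OpenNormalSubgroup P, (N : Set P) ⊆ U ∧
      ∃ (G : Subgroup (P ⧸ N.toSubgroup)) (_ : IsFreeGroup G), G.Normal ∧ G.FiniteIndex ∧
        Finite (IsFreeGroup.Generators G) ∧ ∃ a ∈ G, ∃ b ∈ G, a * b ≠ b * a) :
    ∀ U ∈ 𝓝 (1 : P), ∃ J : OpenNormalSubgroup P, (J : Set P) ⊆ U ∧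
      Group.FG (P ⧸ J.toSubgroup) ∧ ∃ N : Subgroup (P ⧸ J.toSubgroup),
        N.Normal ∧ N.FiniteIndex ∧ IsFreeGroup N := by
  intro U hU
  obtain ⟨N, hNU, G, hG, hGn, hGfi, hGfin, -⟩ := htower₀ U hU
  haveI := hG
  exact ⟨N, hNU, fg_and_virtuallyFree_of_freeNormal G hGn hGfi hGfin⟩

/-! ### Lemma 6.3 (iii) for subgroups dense in an open subgroup of finite index -/

omit [IsTopologicalGroup Ph] in
/-- The image in a discrete quotient `Π/N` (`N` open) of a subgroup dense in the subgroup `U` is the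
image of `U`. [cite: MochizukiSemiAnbd2006, Lem 6.3(iii) p.70] -/
theorem map_mk_eq_map_mk_of_closure_eq (N : OpenNormalSubgroup P) {F₁ U : Subgroup P}
    (h₁ : closure (F₁ : Set P) = U) :
    F₁.map (QuotientGroup.mk' N.toSubgroup) = U.map (QuotientGroup.mk' N.toSubgroup) := by
  have hF₁U : F₁ ≤ U := fun x hx => by
    rw [← SetLike.mem_coe, ← h₁]
    exact subset_closure hx
  apply le_antisymm (Subgroup.map_mono hF₁U)
  rintro _ ⟨x, hx, rfl⟩
  have hx' : x ∈ closure (F₁ : Set P) := by rw [h₁]; exact hx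
  have hopen : IsOpen ((fun y => x * y) '' (N : Set P)) :=
    (Homeomorph.mulLeft x).isOpenMap _ N.toOpenSubgroup.isOpen
  obtain ⟨z, ⟨m, hm, rfl⟩, hzF⟩ :=
    mem_closure_iff.mp hx' _ hopen ⟨1, N.toSubgroup.one_mem, mul_one x⟩
  refine ⟨x * m, hzF, ?_⟩
  rw [QuotientGroup.mk'_apply, QuotientGroup.mk'_apply, QuotientGroup.eq]
  simpa using N.toSubgroup.inv_mem hm

/-- **[SemiAnbd] Lemma 6.3 (iii) "after replacing `F` by an open subgroup of finite index"**, generic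
form over a tempered group `Π` with profinite completion `ι : Π → Π̂` and a good tower `htower₀`: if
`F₁, F₂ ≤ Π` are both DENSE IN AN OPEN SUBGROUP `U` OF FINITE INDEX and `f ∈ Π̂` conjugates `ι(F₁)`
onto `ι(F₂)`, then `f ∈ ι(Π)` (and hence `f ∈ ι(U)` as soon as `f` lies in the closure of `ι(U)`,
`mem_of_map_mem_closure`).  At each good level `N` the images of `F₁, F₂` in `Π/N` equal `U/N`, so the
image of `f` normalises the image of `U/N` in `(Π/N)^` and lies in the image of `Π/N` by [EtTh]
Lem. 2.17 (i) (`lem217_i`; `(U/N) ∩ G` has finite index in the non-abelian free `G`, hence is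
non-abelian, `exists_not_commute_of_finiteIndex`); the levels glue by
`IsTempered.exists_apply_eq_of_levelwise`. [cite: MochizukiSemiAnbd2006, Lem 6.3(iii) p.70] -/
theorem IsTempered.mem_range_of_conj_eq_of_closure_eq (hP : IsTempered P) (ι : P →ₜ* Ph)
    (hι : IsProfiniteCompletion ι)
    (htower₀ : ∀ U ∈ 𝓝 (1 : P), ∃ N : OpenNormalSubgroup P, (N : Set P) ⊆ U ∧
      ∃ (G : Subgroup (P ⧸ N.toSubgroup)) (_ : IsFreeGroup G), G.Normal ∧ G.FiniteIndex ∧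
        Finite (IsFreeGroup.Generators G) ∧ ∃ a ∈ G, ∃ b ∈ G, a * b ≠ b * a)
    {U F₁ F₂ : Subgroup P} [U.FiniteIndex] (h₁ : closure (F₁ : Set P) = U)
    (h₂ : closure (F₂ : Set P) = U) (f : Ph)
    (hconj : ∀ x ∈ F₁, ∃ y ∈ F₂, f * ι x * f⁻¹ = ι y)
    (hconj' : ∀ y ∈ F₂, ∃ x ∈ F₁, f * ι x * f⁻¹ = ι y) :
    f ∈ ι.toMonoidHom.range := by
  classical
  let Good : OpenNormalSubgroup P → Prop := fun N =>
    ∃ (G : Subgroup (P ⧸ N.toSubgroup)) (_ : IsFreeGroup G), G.Normal ∧ G.FiniteIndex ∧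
      Finite (IsFreeGroup.Generators G) ∧ ∃ a ∈ G, ∃ b ∈ G, a * b ≠ b * a
  have hgood : ∀ U ∈ 𝓝 (1 : P), ∃ N : OpenNormalSubgroup P, (N : Set P) ⊆ U ∧ Good N := htower₀
  have hrf : ∀ N, Good N → Group.ResiduallyFinite (P ⧸ N.toSubgroup) := by
    rintro N ⟨G, hG, hGn, hGfi, -, -⟩
    haveI := hG
    haveI := hGfi
    haveI := residuallyFinite_of_isFreeGroup G
    exact residuallyFinite_of_finiteIndex G
  obtain ⟨n, hn⟩ := hP.exists_apply_eq_of_levelwise ι hι f Good hgood hrf (by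
    rintro N ⟨G, hG, hGn, hGfi, hGfin, a, ha, b, hb, hab⟩
    haveI := hG
    haveI := hGfi
    obtain ⟨ψ, hψV, hψι, hψ⟩ := exists_hom_completion_quotient ι hι N
    let π : P →* P ⧸ N.toSubgroup := QuotientGroup.mk' N.toSubgroup
    let ηQ : (P ⧸ N.toSubgroup) →* completion (GrpCat.of (P ⧸ N.toSubgroup)) :=
      (ProfiniteGrp.ProfiniteCompletion.eta (GrpCat.of (P ⧸ N.toSubgroup))).hom
    have hηQ : ∀ (q : P ⧸ N.toSubgroup) (M : FiniteIndexNormalSubgroup (P ⧸ N.toSubgroup)),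
        (ηQ q).val M = (QuotientGroup.mk q : (P ⧸ N.toSubgroup) ⧸ M.toSubgroup) := fun _ _ => rfl
    have hψι' : ∀ x : P, ψ (ι x) = ηQ (π x) := by
      intro x
      apply ext_val
      intro M
      rw [hψι, hηQ, QuotientGroup.mk'_apply]
    -- the images of `F₁`, `F₂` at level `N` are `U/N`
    have hF₁ : F₁.map π = U.map π := map_mk_eq_map_mk_of_closure_eq N h₁
    have hF₂ : F₂.map π = U.map π := map_mk_eq_map_mk_of_closure_eq N h₂
    -- `ψ f` normalises `ηQ (U/N)`
    have h1 : ψ f ∈ Subgroup.normalizer ((((U.map π).map ηQ : Subgroup _)) : Set _) := by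
      rw [Subgroup.mem_normalizer_iff]
      intro z
      constructor
      · rintro ⟨q, hq, rfl⟩
        rw [← hF₁] at hq
        obtain ⟨x, hx, rfl⟩ := hq
        obtain ⟨y, hy, hxy⟩ := hconj x hx
        refine ⟨π y, ?_, ?_⟩
        · rw [← hF₂]
          exact ⟨y, hy, rfl⟩
        · rw [← hψι', ← hψι', ← hxy, map_mul, map_mul, map_inv]
      · rintro ⟨q, hq, hqz⟩
        rw [← hF₂] at hq
        obtain ⟨y, hy, rfl⟩ := hq
        obtain ⟨x, hx, hxy⟩ := hconj' y hy
        refine ⟨π x, ?_, ?_⟩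
        · rw [← hF₁]
          exact ⟨x, hx, rfl⟩
        · have e : ψ f * ψ (ι x) * (ψ f)⁻¹ = ηQ (π y) := by
            rw [← hψι', ← hxy, map_mul, map_mul, map_inv]
          have hz : z = ψ (ι x) := by
            have := hqz.symm.trans e.symm
            exact mul_left_cancel (mul_right_cancel this)
          rw [hz, hψι']
    -- `(U/N) ∩ G` is non-abelian: finite index in the non-abelian free group `G`
    haveI : (U.map π).FiniteIndex := by
      rw [Subgroup.finiteIndex_iff]
      exact ne_zero_of_dvd_ne_zero Subgroup.FiniteIndex.index_ne_zero
        (Subgroup.index_map_dvd _ (QuotientGroup.mk'_surjective N.toSubgroup))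
    have hab' : (⟨a, ha⟩ : G) * ⟨b, hb⟩ ≠ ⟨b, hb⟩ * ⟨a, ha⟩ := fun h =>
      hab (by simpa using congrArg Subtype.val h)
    obtain ⟨x, hx, y, hy, hxy⟩ := exists_not_commute_of_finiteIndex hab' ((U.map π).subgroupOf G)
    have hnc : ∃ a ∈ U.map π ⊓ G, ∃ b ∈ U.map π ⊓ G, a * b ≠ b * a :=
      ⟨x, Subgroup.mem_inf.mpr ⟨Subgroup.mem_subgroupOf.mp hx, x.2⟩, y,
        Subgroup.mem_inf.mpr ⟨Subgroup.mem_subgroupOf.mp hy, y.2⟩, fun h => hxy (Subtype.ext h)⟩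
    -- [EtTh] Lem. 2.17 (i) at `H = U/N`
    have h2 : Subgroup.normalizer ((((U.map π).map ηQ : Subgroup _)) : Set _) =
        (Subgroup.normalizer (((U.map π : Subgroup (P ⧸ N.toSubgroup))) :
          Set (P ⧸ N.toSubgroup))).map ηQ :=
      lem217_i (P ⧸ N.toSubgroup) G (U.map π) hGn hGfi hGfin hnc
    rw [h2] at h1
    obtain ⟨q, -, hqf⟩ := h1
    obtain ⟨n, rfl⟩ := QuotientGroup.mk'_surjective N.toSubgroup q
    refine ⟨n, fun M V hMV => (hψ f M n V hMV).mp ?_⟩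
    rw [← hqf]
    exact hηQ _ M)
  exact ⟨n, hn⟩

/-- For a subgroup `H` of DOF-type contained in an open subgroup `U` of finite index with
`cl ι(H) = cl ι(U)` in the profinite completion, `H` is dense in `U`: the open finite-index subgroup
`U'` in which `H` is dense has `cl ι(U') = cl ι(H) = cl ι(U)`, and both `U, U'` are pulled back from
their closures (`comap_topologicalClosure_map`). [cite: MochizukiSemiAnbd2006, Lem 6.3(iii) p.70] -/
theorem IsProfiniteCompletion.closure_eq_of_isDOFType_of_closure_image_eq {ι : P →ₜ* Ph}
    (hι : IsProfiniteCompletion ι) {U H : Subgroup P} (hU : IsOpen (U : Set P)) [U.FiniteIndex]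
    (hH : IsDOFType H)
    (hcl : closure (ι '' (H : Set P)) = closure (ι '' (U : Set P))) :
    closure (H : Set P) = U := by
  obtain ⟨U', hU'o, hU'fi, hcl'⟩ := hH
  haveI := hU'fi
  have hHU' : H ≤ U' := fun h hh => by
    rw [← SetLike.mem_coe, ← hcl']
    exact subset_closure hh
  -- `cl ι U' = cl ι H`
  have h1 : closure (ι '' (U' : Set P)) = closure (ι '' (H : Set P)) := by
    apply le_antisymm
    · refine closure_minimal ?_ isClosed_closure
      calc ι '' (U' : Set P) = ι '' closure (H : Set P) := by rw [hcl']
        _ ⊆ closure (ι '' (H : Set P)) := image_closure_subset_closure_image ι.continuous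
    · exact closure_mono (Set.image_mono hHU')
  have h2 : (U'.map ι.toMonoidHom).topologicalClosure = (U.map ι.toMonoidHom).topologicalClosure := by
    apply SetLike.coe_injective
    rw [Subgroup.topologicalClosure_coe, Subgroup.topologicalClosure_coe, Subgroup.coe_map,
      Subgroup.coe_map]
    change closure (ι '' (U' : Set P)) = closure (ι '' (U : Set P))
    rw [h1, hcl]
  have h3 : U' = U := by
    rw [← IsProfiniteCompletion.comap_topologicalClosure_map hι U' hU'o, h2,
      IsProfiniteCompletion.comap_topologicalClosure_map hι U hU]
  rw [hcl', h3]

end Generic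

namespace TemperedCurve

variable {p : ℕ} [Fact p.Prime]

/-! ### Lemma 6.3 (ii) and T64-L06′ = Lemma 6.3 (iii) at the coverings, under the tower input -/

/-- **T64-L06′ = [SemiAnbd] Lemma 6.3 (iii) at the finite étale coverings** (the sub-node
`Y.OpenDenseDOFConjugator` of the Thm. 6.4 sub-DAG, abc-iut-w5-d139): for every open subgroup of finite
index `U ≤ Π^temp_{Y_L}`, DOF-type subgroups `F₁, F₂ ≤ U` dense in `Û = cl ι(U)` and `c ∈ Û` with
`c · ι(F₁) · c⁻¹ = ι(F₂)` force `c ∈ ι(U)` — PROVED modulo `IsTempered Y.PiTemp` and the tower input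
`htower₀` (via `IsTempered.mem_range_of_conj_eq_of_closure_eq` and `mem_of_map_mem_closure`).
[cite: MochizukiSemiAnbd2006, Lem 6.3(iii) p.70; Thm 6.4 proof p.71] -/
theorem openDenseDOFConjugator_of_tower (Y : TemperedCurve p) (hT : IsTempered Y.PiTemp)
    (htower₀ : ∀ U ∈ 𝓝 (1 : Y.PiTemp), ∃ N : OpenNormalSubgroup Y.PiTemp, (N : Set Y.PiTemp) ⊆ U ∧
      ∃ (G : Subgroup (Y.PiTemp ⧸ N.toSubgroup)) (_ : IsFreeGroup G), G.Normal ∧ G.FiniteIndex ∧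
        Finite (IsFreeGroup.Generators G) ∧ ∃ a ∈ G, ∃ b ∈ G, a * b ≠ b * a) :
    Y.OpenDenseDOFConjugator := by
  intro U hUo hUfi F₁ F₂ _ _ hF₁ hF₂ hcl₁ hcl₂ c hc hconj
  haveI := hUfi
  have h₁ := Y.isProfiniteCompletion_toHat.closure_eq_of_isDOFType_of_closure_image_eq hUo hF₁ hcl₁
  have h₂ := Y.isProfiniteCompletion_toHat.closure_eq_of_isDOFType_of_closure_image_eq hUo hF₂ hcl₂
  have hmem : c ∈ Y.toHat.toMonoidHom.range := by
    refine hT.mem_range_of_conj_eq_of_closure_eq Y.toHat Y.isProfiniteCompletion_toHat htower₀ h₁ h₂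
      c ?_ ?_
    · intro x hx
      have hm : (ConjAct.toConjAct c) • Y.toHat x ∈ (ConjAct.toConjAct c) • F₁.map Y.toHat.toMonoidHom :=
        Subgroup.smul_mem_pointwise_smul (Y.toHat x) (ConjAct.toConjAct c) (F₁.map Y.toHat.toMonoidHom)
          ⟨x, hx, rfl⟩
      rw [hconj] at hm
      obtain ⟨y, hy, hye⟩ := hm
      refine ⟨y, hy, ?_⟩
      rw [ConjAct.smul_def, ConjAct.ofConjAct_toConjAct] at hye
      exact hye.symm
    · intro y hy
      have hm : Y.toHat y ∈ (ConjAct.toConjAct c) • F₁.map Y.toHat.toMonoidHom := by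
        rw [hconj]
        exact ⟨y, hy, rfl⟩
      obtain ⟨z, ⟨x, hx, rfl⟩, hze⟩ :=
        (Subgroup.mem_smul_pointwise_iff_exists (Y.toHat y) (ConjAct.toConjAct c)
          (F₁.map Y.toHat.toMonoidHom)).mp hm
      refine ⟨x, hx, ?_⟩
      rw [ConjAct.smul_def, ConjAct.ofConjAct_toConjAct] at hze
      exact hze
  obtain ⟨n, rfl⟩ := hmem
  exact ⟨n, IsProfiniteCompletion.mem_of_map_mem_closure Y.isProfiniteCompletion_toHat U hUo hc, rfl⟩

end TemperedCurve

namespace TemperedOrigin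

variable {p : ℕ} [Fact p.Prime]

/-- **[SemiAnbd] Theorem 6.6 as printed** (origin-quantified, `Ω.ProfiniteOuterIsoLiftsHolds`), modulo
the specialisation isomorphism systems of its printed proof (`Ω.SpecializationIsoSystemHolds`) and — for
every certified `Y` — `IsTempered Y.PiTemp` with the tower input (`htw`); the Lemma 6.1 (iii) input of
`profiniteOuterIsoLiftsHolds_of` is DISCHARGED over the tower (`piTempNormallyTerminal_of_tower`).
[cite: MochizukiSemiAnbd2006, Thm 6.6 pp.72-73] -/
theorem profiniteOuterIsoLiftsHolds_of_tower (Ω : TemperedOrigin p) (hS : Ω.SpecializationIsoSystemHolds)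
    (htw : ∀ Y : TemperedCurve p, Ω.IsHyperbolicCurveOrigin Y → IsTempered Y.PiTemp ∧
      ∀ U ∈ 𝓝 (1 : Y.PiTemp), ∃ N : OpenNormalSubgroup Y.PiTemp, (N : Set Y.PiTemp) ⊆ U ∧
        ∃ (G : Subgroup (Y.PiTemp ⧸ N.toSubgroup)) (_ : IsFreeGroup G), G.Normal ∧ G.FiniteIndex ∧
          Finite (IsFreeGroup.Generators G) ∧ ∃ a ∈ G, ∃ b ∈ G, a * b ≠ b * a) :
    Ω.ProfiniteOuterIsoLiftsHolds := fun X Y hX hY =>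
  TemperedCurve.profiniteOuterIsoLifts_of_system (hS X Y hX hY)
    (Y.piTempNormallyTerminal_of_tower (htw Y hY).1 (htw Y hY).2)

end TemperedOrigin

end Literature.AnabelianGeometry.SemiGraphs

end
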